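import Literature.Probability.LatticeModels.CollarLegModelRainbow
import Literature.Probability.Percolation.FKLoopWindingCells

/-!
# The medial strand representation of the collar leg model, V: the cell region in medial
# coordinates

The height representation of `Literature.Probability.LatticeModels.CollarLegModel` with prescribed
boundary data (insertion dictionary, crux `BoundaryDefectGaussianR`) constructs heights from the
combinatorial winding numbers `MedialTrail.wnd` of strands closed by rim arcs
(`MedialPolygonWinding.lean`). This file places the model in the medial coordinates of
`MedialTrail`/`FKLoopWindingCells`: every cell (vertex-cell or face-cell) is a unit square
`vcell x` / `fcell f` of the medial lattice, and a corner `c` is the dart `cornerDart c` with the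
cell of its vertex on the left and the cell of its face on the right.

* `CollarLegModel.cellRegion M` — the finite set of medial cells of the model;
* `mem_cellRegion_vcell_iff`, `mem_cellRegion_fcell_iff` — vertex squares and face squares have
  different parities, so membership is read on the respective cell sets;
* `isTracked_iff_cornerDart` — a corner is tracked iff both sides of its dart are cells of the
  region (the rim of the region = the medial steps with exactly one side in it).

[BaxterKellandWu1976, §3–§4] (height/loop correspondence); everything is proved.
-/

namespace Literature.Probability.LatticeModels

namespace CollarLegModel

open Finset Percolation MedialTrail

/-- Vertex squares have odd coordinate sum. [folklore] -/
theorem vcell_parity (v : Site 2) : ((vcell v).1 + (vcell v).2) % 2 = 1 := by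
  simp only [vcell]; omega

/-- Face squares have even coordinate sum. [folklore] -/
theorem fcell_parity (f : Site 2) : ((fcell f).1 + (fcell f).2) % 2 = 0 := by
  simp only [fcell]; omega

/-- A vertex square is never a face square. [folklore] -/
theorem vcell_ne_fcell (v f : Site 2) : vcell v ≠ fcell f := fun h => by
  have h1 := vcell_parity v
  rw [h, fcell_parity] at h1
  exact zero_ne_one h1

/-- `vcell` is injective. [folklore] -/
theorem vcell_injective : Function.Injective vcell := fun v w h => by
  simp only [vcell, Prod.mk.injEq] at h
  funext i; fin_cases i <;> simp <;> omega

/-- `fcell` is injective. [folklore] -/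
theorem fcell_injective : Function.Injective fcell := fun v w h => by
  simp only [fcell, Prod.mk.injEq] at h
  funext i; fin_cases i <;> simp <;> omega

variable (M : CollarLegModel)

/-- **The cell region** of the collar model in medial coordinates: the unit squares of its
vertex-cells and of its face-cells. [cite: BaxterKellandWu1976, §3] -/
noncomputable def cellRegion : Finset MedialTrail.Pt :=
  M.vertexCells.image (fun x => vcell (toSite x)) ∪ M.faceCells.image (fun f => fcell (toSite f))

/-- A vertex square lies in the cell region iff its vertex is a vertex-cell. [folklore] -/
theorem mem_cellRegion_vcell_iff (x : Site 2) : vcell x ∈ M.cellRegion ↔ ofSite x ∈ M.vertexCells := by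
  rw [cellRegion, mem_union, mem_image, mem_image]
  constructor
  · rintro (⟨y, hy, h⟩ | ⟨f, _, h⟩)
    · rw [← vcell_injective h, ofSite_toSite]; exact hy
    · exact absurd h.symm (vcell_ne_fcell x _)
  · intro h
    exact Or.inl ⟨ofSite x, h, by congr 1; funext i; fin_cases i <;> simp [toSite, ofSite]⟩

/-- A face square lies in the cell region iff its face is a face-cell. [folklore] -/
theorem mem_cellRegion_fcell_iff (f : Site 2) : fcell f ∈ M.cellRegion ↔ ofSite f ∈ M.faceCells := by
  rw [cellRegion, mem_union, mem_image, mem_image]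
  constructor
  · rintro (⟨y, _, h⟩ | ⟨g, hg, h⟩)
    · exact absurd h (vcell_ne_fcell _ f)
    · rw [← fcell_injective h, ofSite_toSite]; exact hg
  · intro h
    exact Or.inr ⟨ofSite f, h, by congr 1; funext i; fin_cases i <;> simp [toSite, ofSite]⟩

/-- **A corner is tracked iff both sides of its dart are cells of the region** (vertex square on
the left, face square on the right). [cite: BaxterKellandWu1976, §4] -/
theorem isTracked_iff_cornerDart (c : Site 2 × Fin 4) :
    M.IsTracked c ↔ lf (cornerDart c) ∈ M.cellRegion ∧ rf (cornerDart c) ∈ M.cellRegion := by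
  rw [lf_cornerDart, rf_cornerDart, mem_cellRegion_vcell_iff, mem_cellRegion_fcell_iff, IsTracked]

/-- A rim step of the region (exactly one side a cell) is never the dart of a tracked corner. [folklore] -/
theorem not_isTracked_of_rim {c : Site 2 × Fin 4}
    (h : lf (cornerDart c) ∉ M.cellRegion ∨ rf (cornerDart c) ∉ M.cellRegion) : ¬M.IsTracked c := by
  rw [isTracked_iff_cornerDart]
  tauto

end CollarLegModel

end Literature.Probability.LatticeModels
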